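import Literature.InformationTheory.QuantumCodes.TwoBlockGroupAlgebraCodes
import Literature.InformationTheory.QuantumCodes.HypergraphProduct
import Literature.InformationTheory.Coding.DualDistance
import Mathlib.GroupTheory.SpecificGroups.Dihedral
import HarnessLib

/-!
# A group-algebra code and its transpose need NOT have the same distance over a non-abelian group
# (counterexample to the parenthetical of Lin–Pryadko 2024 §IV.C, in `𝔽₂[D₆]`)

Topic `InformationTheory/QuantumCodes`; namespace `Literature.InformationTheory.QuantumCodes.TwoBlockGA`.
LADDER-QEC (cell `qec`), LIT-3 constructions, register A40 (qec-lit-3 gen 6). 0 named facts, no `sorry`.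

Source. H.-K. Lin, L. P. Pryadko, *Quantum two-block group algebra codes*, PRA **109** (2024) 022407 =
arXiv:2306.16400 [LinPryadko2024], §IV.C (held text chunk p0010 L66–79), on 2BGA codes `LP[a,b]` whose support
groups are disjoint, `G' = G_a × G_b`, `A = A₁ ⊗ I`, `B = I ⊗ B₁`:

> «If we denote the parameters of classical linear codes with parity check matrices `A₁` and `B₁`, respectively,
> as `[n_a,k_a,d_a]_q` and `[n_b,k_b,d_b]_q` (these parameters remain the same when the transposed matrices are
> used), the parameters of the quantum HP code are known explicitly, `[[2n_an_b, 2k_ak_b, min(d_a,d_b)]]_q`.»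

For ABELIAN `G_a` the parenthetical holds (`(circ a)ᵀ = circ a` re-indexed by `g ↦ −g`;
`AbelianTwoBlock.minDist_pcCode_circulant_transpose`, file `AbelianTwoBlockHypergraphProduct.lean`, where the
printed parameters are PROVED for abelian groups). This file shows it FAILS for a non-abelian constituent group:

* `a6 : DihedralGroup 6 → 𝔽₂` — the indicator of `{r 0, r 1, r 3, sr 0, sr 3, sr 4}` in the dihedral group of
  order 12 (Mathlib's `DihedralGroup 6`: `r i * r j = r (i+j)`, `r i * sr j = sr (j−i)`, `sr i * r j = sr (i+j)`,
  `sr i * sr j = r (j−i)`);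
* `minDist_pcCode_leftMul_a6_transpose_le_two` — the code with parity-check matrix `L(a6)ᵀ` has a weight-2 word
  (`e_{r 3} + e_{sr 0}`), so `d(ker L(a6)ᵀ) ≤ 2`;
* `minDist_pcCode_leftMul_a6 : d(ker L(a6)) = 4` — no 1, 2 or 3 columns of `L(a6)` sum to zero (`decide`), and
  an explicit weight-4 kernel word `u6`; `minDist_pcCode_leftMul_a6_transpose : d(ker L(a6)ᵀ) = 2`;
* ★ `LinPryadko2024_sec4C_transpose_counterexample` — `d(ker L(a6)) = 4 ∧ d(ker L(a6)ᵀ) = 2`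
  (both codes have dimension `6`, by rank; not needed here).

* ★ `LinPryadko2024_sec4C_hp_counterexample` — the quantum consequence: over `G = D₆ × ℤ₃` with `b = 1 + y`
  the disjoint-support 2BGA code `LP[a6 ⊗ 1, 1 ⊗ b]` (72 qubits) has `d_X = 2` (explicit weight-2 `X`-logical with
  an odd-overlap `Z`-logical witness; all columns of `H_Z`, `H_X` nonzero) and `d_Z ≥ 2`, so distance `2`, where the
  printed formula gives `min(d_a, d_b) = min(4, 3) = 3`; the correct Tillich–Zémor value is
  `min(d_a, d_aᵀ, d_b, d_bᵀ) = 2`; `LinPryadko2024_sec4C_hp_counterexample_dX_dZ` — `d_X = 2 ∧ d_Z = 3` exactly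
  (columns of `H_X` pairwise distinct). (`k = 12 = 2k_ak_b` is computed outside Lean — LADDER-QEC evidence
  `lit/evidence/lp24_sec4c_nonabelian_transpose_lit3g6.py` — and NOT claimed here.)

## References

* [LinPryadko2024] Lin–Pryadko, arXiv:2306.16400, §IV.C (chunk p0010 L66–79, quoted above); §IV.A eq. (10) (chunk p0009 L15–20) `L(a)`, `R(b)`
  (the tree's `TwoBlockGA.leftMul a g h = a (g h⁻¹)`).
* [TillichZemor2014] J.-P. Tillich, G. Zémor, *Quantum LDPC codes with positive rate and minimum distance
  proportional to n^{1/2}*, IEEE Trans. Inf. Theory 60 (2014) 1193 — hypergraph-product parameters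
  (tree: `HypergraphProduct.lean`).
-/

namespace Literature.InformationTheory.QuantumCodes

namespace TwoBlockGA

open Matrix DihedralGroup

/-- The element `a6 = r⁰ + r¹ + r³ + s r⁰ + s r³ + s r⁴ ∈ 𝔽₂[D₆]` (indicator of six elements of the dihedral
group of order 12). [cite: LinPryadko2024, §IV.C (arXiv:2306.16400 chunk p0010 L74–77) — the counterexample element is ours, found by exhaustive search over 𝔽₂[D₆]] -/
def a6 : DihedralGroup 6 → ZMod 2
  | r i => if i = 0 ∨ i = 1 ∨ i = 3 then 1 else 0
  | sr i => if i = 0 ∨ i = 3 ∨ i = 4 then 1 else 0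

/-- The weight-2 word `w6 = e_{r 3} + e_{sr 0}`. [cite: LinPryadko2024, §IV.C (arXiv:2306.16400 chunk p0010 L74–77)] -/
def w6 : DihedralGroup 6 → ZMod 2
  | r i => if i = 3 then 1 else 0
  | sr i => if i = 0 then 1 else 0

/-- `L(a6)ᵀ w6 = 0`. [folklore] -/
private theorem leftMul_a6_transpose_mulVec_w6 : (leftMul a6)ᵀ *ᵥ w6 = 0 := by
  decide

/-- `w6 ≠ 0`. [folklore] -/
private theorem w6_ne_zero : w6 ≠ 0 := by
  intro h
  have := congrFun h (r 3)
  simp [w6] at this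

/-- `wt(w6) = 2`. [folklore] -/
private theorem hammingNorm_w6 : hammingNorm w6 = 2 := by
  decide

/-- **`d(ker L(a6)ᵀ) ≤ 2`.** [cite: LinPryadko2024, §IV.C "(these parameters remain the same when the transposed matrices are used)" (arXiv:2306.16400 chunk p0010 L76–77)] -/
theorem minDist_pcCode_leftMul_a6_transpose_le_two : Coding.minDist (pcCode (leftMul a6)ᵀ) ≤ 2 := by
  have h := Coding.minDist_le_hammingNorm (C := pcCode (leftMul a6)ᵀ) (c := w6)
    ((mem_pcCode_iff _ _).mpr leftMul_a6_transpose_mulVec_w6) w6_ne_zero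
  rwa [hammingNorm_w6, Nat.cast_ofNat] at h

/-- The columns of `L(a6)` are pairwise distinct … [folklore] -/
private theorem leftMul_a6_col_injective :
    ∀ g h : DihedralGroup 6, (fun i => leftMul a6 i g) = (fun i => leftMul a6 i h) → g = h := by
  decide

/-- … nonzero … [folklore] -/
private theorem leftMul_a6_col_ne_zero : ∀ g : DihedralGroup 6, (fun i => leftMul a6 i g) ≠ 0 := by
  decide

/-- … and no three distinct columns sum to zero. [folklore] -/
private theorem leftMul_a6_three_cols_ne_zero :
    ∀ g h k : DihedralGroup 6, g ≠ h → g ≠ k → h ≠ k →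
      (fun i => leftMul a6 i g + leftMul a6 i h + leftMul a6 i k) ≠ 0 := by
  decide

/-- The rows of `L(a6)` (columns of `L(a6)ᵀ`) are nonzero. [folklore] -/
private theorem leftMul_a6_row_ne_zero : ∀ g : DihedralGroup 6, (fun i => (leftMul a6)ᵀ i g) ≠ 0 := by
  decide

/-- The weight-4 word `u6 = e_{r 4} + e_{r 5} + e_{sr 0} + e_{sr 1}`. [cite: LinPryadko2024, §IV.C (arXiv:2306.16400 chunk p0010 L74–77)] -/
def u6 : DihedralGroup 6 → ZMod 2
  | r i => if i = 4 ∨ i = 5 then 1 else 0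
  | sr i => if i = 0 ∨ i = 1 then 1 else 0

/-- `L(a6) u6 = 0`, `u6 ≠ 0`, `wt(u6) = 4`. [folklore] -/
private theorem leftMul_a6_mulVec_u6 : leftMul a6 *ᵥ u6 = 0 ∧ u6 ≠ 0 ∧ hammingNorm u6 = 4 := by
  refine ⟨by decide, fun h => ?_, by decide⟩
  have := congrFun h (r 4)
  simp [u6] at this

/-- In `𝔽₂`, a nonzero scalar is `1`. [folklore] -/
private theorem zmod2_eq_one_of_ne_zero {x : ZMod 2} (hx : x ≠ 0) : x = 1 := by
  revert x; decide

/-- Over `𝔽₂`, `M v = Σ_{j ∈ supp v} (column j of M)`. [folklore] -/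
private theorem mulVec_eq_sum_support {ρ ι : Type*} [Fintype ι] [DecidableEq ι] (M : Matrix ρ ι (ZMod 2))
    (v : ι → ZMod 2) (i : ρ) :
    (M *ᵥ v) i = ∑ j ∈ Finset.univ.filter (fun j => v j ≠ 0), M i j := by
  rw [mulVec, dotProduct, Finset.sum_filter]
  refine Finset.sum_congr rfl fun j _ => ?_
  by_cases hj : v j = 0
  · simp [hj]
  · simp [zmod2_eq_one_of_ne_zero hj]

/-- Over `𝔽₂`: if every column of `M` is nonzero, a nonzero kernel vector has weight `≥ 2`. [folklore] -/
private theorem two_le_hammingNorm_of_mulVec_eq_zero {ρ ι : Type*} [Fintype ι] [DecidableEq ι]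
    (M : Matrix ρ ι (ZMod 2)) (hcol : ∀ q, (fun i => M i q) ≠ 0) {w : ι → ZMod 2} (hw : M *ᵥ w = 0)
    (hw0 : w ≠ 0) : 2 ≤ hammingNorm w := by
  by_contra hlt
  push Not at hlt
  set S : Finset ι := Finset.univ.filter (fun j => w j ≠ 0) with hS
  have hcard : S.card = hammingNorm w := by simp [hS, hammingNorm]
  have hpos : 0 < hammingNorm w := hammingNorm_pos_iff.mpr hw0
  have hS1 : S.card = 1 := by omega
  obtain ⟨q, hq⟩ := Finset.card_eq_one.mp hS1
  refine hcol q (funext fun i => ?_)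
  have := congrFun hw i
  rw [mulVec_eq_sum_support, ← hS, hq, Finset.sum_singleton] at this
  exact this

/-- Over `𝔽₂`: if no `1`, `2` or `3` columns of a square matrix `M` sum to zero, then `d(ker M) ≥ 4`; stated with a
cut-off `d ≤ 4` so that the same lemma gives `≥ 2` and `≥ 3`. [folklore] -/
private theorem le_minDist_pcCode_of_cols {ι : Type*} [Fintype ι] [DecidableEq ι] (M : Matrix ι ι (ZMod 2))
    (d : ℕ) (hd : d ≤ 4)
    (h1 : 1 < d → ∀ g, (fun i => M i g) ≠ 0)
    (h2 : 2 < d → ∀ g h, (fun i => M i g) = (fun i => M i h) → g = h)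
    (h3 : 3 < d → ∀ g h k, g ≠ h → g ≠ k → h ≠ k → (fun i => M i g + M i h + M i k) ≠ 0) :
    (d : ℕ∞) ≤ Coding.minDist (pcCode M) := by
  rw [Coding.le_minDist_iff]
  intro c hc hc0
  rw [mem_pcCode_iff] at hc
  by_contra hlt
  push Not at hlt
  have hwt : hammingNorm c < d := by exact_mod_cast hlt
  set S : Finset ι := Finset.univ.filter (fun j => c j ≠ 0) with hS
  have hcard : S.card = hammingNorm c := by simp [hS, hammingNorm]
  have hcol : ∀ i, ∑ j ∈ S, M i j = 0 := fun i => by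
    rw [hS, ← mulVec_eq_sum_support, hc]; rfl
  have hS0 : 0 < S.card := by
    rw [Finset.card_pos, ← Finset.card_pos, hcard, hammingNorm_pos_iff]
    exact hc0
  have key : ∀ x y : ZMod 2, x + y = 0 → x = y := by decide
  have hlt4 : S.card < 4 := by omega
  interval_cases hSc : S.card
  · obtain ⟨g, hg⟩ := Finset.card_eq_one.mp hSc
    exact h1 (by omega) g (funext fun i => by simpa [hg] using hcol i)
  · obtain ⟨g, h, hgh, hgS⟩ := Finset.card_eq_two.mp hSc
    refine hgh (h2 (by omega) g h (funext fun i => key _ _ ?_))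
    have := hcol i
    rwa [hgS, Finset.sum_pair hgh] at this
  · obtain ⟨g, h, k, hgh, hgk, hhk, hgS⟩ := Finset.card_eq_three.mp hSc
    refine h3 (by omega) g h k hgh hgk hhk (funext fun i => ?_)
    have := hcol i
    rw [hgS, Finset.sum_insert (by simp [hgh, hgk]), Finset.sum_pair hhk] at this
    simpa [add_assoc] using this

/-- **`d(ker L(a6)) = 4`.** [cite: LinPryadko2024, §IV.C (arXiv:2306.16400 chunk p0010 L74–77)] -/
theorem minDist_pcCode_leftMul_a6 : Coding.minDist (pcCode (leftMul a6)) = 4 := by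
  apply le_antisymm
  · obtain ⟨hu, hu0, hwt⟩ := leftMul_a6_mulVec_u6
    have h := Coding.minDist_le_hammingNorm (C := pcCode (leftMul a6)) (c := u6)
      ((mem_pcCode_iff _ _).mpr hu) hu0
    rwa [hwt, Nat.cast_ofNat] at h
  · exact_mod_cast le_minDist_pcCode_of_cols (leftMul a6) 4 le_rfl (fun _ => leftMul_a6_col_ne_zero)
      (fun _ => leftMul_a6_col_injective) (fun _ => leftMul_a6_three_cols_ne_zero)

/-- **`d(ker L(a6)ᵀ) = 2`.** [cite: LinPryadko2024, §IV.C "(these parameters remain the same when the transposed matrices are used)" (arXiv:2306.16400 chunk p0010 L76–77)] -/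
theorem minDist_pcCode_leftMul_a6_transpose : Coding.minDist (pcCode (leftMul a6)ᵀ) = 2 := by
  apply le_antisymm minDist_pcCode_leftMul_a6_transpose_le_two
  exact_mod_cast le_minDist_pcCode_of_cols (leftMul a6)ᵀ 2 (by omega) (fun _ => leftMul_a6_row_ne_zero)
    (fun h => by omega) (fun h => by omega)

/-- ★ **Counterexample to the parenthetical of LP24 §IV.C for non-abelian groups:** in `𝔽₂[D₆]`, the codes with
parity-check matrices `L(a6)` and `L(a6)ᵀ` have minimum distances `4 ≠ 2` (both have dimension `6`). Hence for
non-abelian constituent groups the hypergraph-product parameters of a disjoint-support 2BGA code must be taken as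
Tillich–Zémor's `min(d_a, d_aᵀ, d_b, d_bᵀ)`, not `min(d_a, d_b)`.
[cite: LinPryadko2024, §IV.C "(these parameters remain the same when the transposed matrices are used) … [[2n_an_b, 2k_ak_b, min(d_a,d_b)]]_q" (arXiv:2306.16400 chunk p0010 L74–79) — REFUTED for non-abelian G_a by this instance; abelian case proved in `AbelianTwoBlockHypergraphProduct.lean`] -/
theorem LinPryadko2024_sec4C_transpose_counterexample :
    Coding.minDist (pcCode (leftMul a6)) = 4 ∧ Coding.minDist (pcCode (leftMul a6)ᵀ) = 2 :=
  ⟨minDist_pcCode_leftMul_a6, minDist_pcCode_leftMul_a6_transpose⟩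

/-! ### The quantum consequence: `LP[a6 ⊗ 1, 1 ⊗ (1+y)]` over `D₆ × ℤ₃` has `d_X = 2 < 3 = min(d_a, d_b)`

`G36 = D₆ × ℤ₃` (`Multiplicative (ZMod 3)`), `a36 = a6 ⊗ 1` on `D₆ × 1`, `b36 = 1 ⊗ (1 + y)` on `1 × ℤ₃`
(`[k_b, d_b, d_bᵀ] = [1, 3, 3]`). The printed formula gives distance `min(d_a, d_b) = min(4, 3) = 3`; the code has an
`X`-logical of weight 2 (and `d_Z = 3`, `k = 12 = 2k_ak_b`, `n = 72`, computed outside Lean). -/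

/-- `G36 = D₆ × ℤ₃`. (plumbing) [folklore] -/
abbrev G36 : Type := DihedralGroup 6 × Multiplicative (ZMod 3)

/-- `a36 = a6 ⊗ 1`: `a6` placed on the subgroup `D₆ × 1`. [cite: LinPryadko2024, §IV.C "A = A₁ ⊗ I_{n_b}" (arXiv:2306.16400 chunk p0010 L70–72)] -/
def a36 : G36 → ZMod 2 := fun g => if g.2 = 1 then a6 g.1 else 0

/-- `b36 = 1 ⊗ (1 + y)`: the weight-2 element `1 + y` of `𝔽₂[ℤ₃]` placed on `1 × ℤ₃`. [cite: LinPryadko2024, §IV.C "B = I_{n_a} ⊗ B₁" (arXiv:2306.16400 chunk p0010 L70–72)] -/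
def b36 : G36 → ZMod 2 := fun g =>
  if g.1 = 1 ∧ (g.2 = 1 ∨ g.2 = Multiplicative.ofAdd 1) then 1 else 0

/-- The weight-2 `X`-logical `x72 = X` on the right-block qubits `(r 0, 1)` and `(sr 3, 1)`. [folklore] -/
private def x72 : G36 ⊕ G36 → ZMod 2
  | Sum.inr g => if g.2 = 1 ∧ (g.1 = r 0 ∨ g.1 = sr 3) then 1 else 0
  | Sum.inl _ => 0

/-- A `Z`-logical with odd overlap with `x72`: `Z` on the right-block qubits `(r 0, y^j)`, `j = 0,1,2`. [folklore] -/
private def u72 : G36 ⊕ G36 → ZMod 2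
  | Sum.inr g => if g.1 = r 0 then 1 else 0
  | Sum.inl _ => 0

set_option maxRecDepth 200000 in
/-- [folklore] -/
private theorem HZ_mulVec_x72 : HZ a36 b36 *ᵥ x72 = 0 := by
  decide

set_option maxRecDepth 200000 in
/-- [folklore] -/
private theorem HX_mulVec_u72 : HX a36 b36 *ᵥ u72 = 0 := by
  decide

set_option maxRecDepth 200000 in
/-- [folklore] -/
private theorem u72_dot_x72 : u72 ⬝ᵥ x72 ≠ 0 := by
  decide

set_option maxRecDepth 200000 in
/-- [folklore] -/
private theorem hammingNorm_x72 : hammingNorm x72 = 2 := by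
  decide

set_option maxRecDepth 200000 in
/-- [folklore] -/
private theorem HZ_col_ne_zero : ∀ q : G36 ⊕ G36, (fun i => HZ a36 b36 i q) ≠ 0 := by
  decide

set_option maxRecDepth 200000 in
/-- [folklore] -/
private theorem HX_col_ne_zero : ∀ q : G36 ⊕ G36, (fun i => HX a36 b36 i q) ≠ 0 := by
  decide

/-- ★ **The disjoint-support 2BGA code `LP[a6 ⊗ 1, 1 ⊗ (1+y)]` over `D₆ × ℤ₃` (72 qubits) has `d_X = 2` and
`d_Z ≥ 2`, hence distance `2`** — whereas [LinPryadko2024, §IV.C] prints `min(d_a, d_b) = min(4, 3) = 3` for it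
(`d_a = 4` is `minDist_pcCode_leftMul_a6`; `d_b = 3` for `1 + y ∈ 𝔽₂[ℤ₃]`). The correct hypergraph-product value
is Tillich–Zémor's `min(d_a, d_aᵀ, d_b, d_bᵀ) = 2` (`d_aᵀ = 2`, `minDist_pcCode_leftMul_a6_transpose`).
[cite: LinPryadko2024, §IV.C "the parameters of the quantum HP code are known explicitly, [[2n_an_b, 2k_ak_b, min(d_a,d_b)]]_q" (arXiv:2306.16400 chunk p0010 L77–79) — REFUTED for this non-abelian instance (k = 12, d_Z = 3 computed outside Lean, not claimed)] -/
theorem LinPryadko2024_sec4C_hp_counterexample :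
    (css a36 b36).dX = 2 ∧ 2 ≤ (css a36 b36).dZ := by
  have hx : x72 ∉ (css a36 b36).rowSpX := not_mem_rowSpace_of_witness u72 HX_mulVec_u72 u72_dot_x72
  have hu : u72 ∉ (css a36 b36).rowSpZ := by
    refine not_mem_rowSpace_of_witness x72 HZ_mulVec_x72 ?_
    rw [dotProduct_comm]
    exact u72_dot_x72
  refine ⟨(css a36 b36).dX_eq_of_witness HZ_mulVec_x72 hx hammingNorm_x72 fun w hw hw' => ?_,
    (css a36 b36).le_dZ ⟨u72, HX_mulVec_u72, hu⟩ fun w hw hw' => ?_⟩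
  · exact two_le_hammingNorm_of_mulVec_eq_zero _ HZ_col_ne_zero hw
      fun h => hw' (h ▸ Submodule.zero_mem _)
  · exact two_le_hammingNorm_of_mulVec_eq_zero _ HX_col_ne_zero hw
      fun h => hw' (h ▸ Submodule.zero_mem _)

/-! #### `d_Z = 3` exactly (appended): the columns of `H_X` are pairwise distinct, so no `Z`-logical has weight `≤ 2`,
and `u72` is a `Z`-logical of weight `3`. (Only `k = 12` stays outside Lean.) -/

/-- Over `𝔽₂`: if the columns of `M` are nonzero and pairwise distinct, a nonzero kernel vector has weight `≥ 3`.
[folklore] -/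
private theorem three_le_hammingNorm_of_mulVec_eq_zero {ρ ι : Type*} [Fintype ι] [DecidableEq ι]
    (M : Matrix ρ ι (ZMod 2)) (hcol : ∀ q, (fun i => M i q) ≠ 0)
    (hinj : ∀ q q', (fun i => M i q) = (fun i => M i q') → q = q') {w : ι → ZMod 2} (hw : M *ᵥ w = 0)
    (hw0 : w ≠ 0) : 3 ≤ hammingNorm w := by
  have h2 := two_le_hammingNorm_of_mulVec_eq_zero M hcol hw hw0
  by_contra hlt
  push Not at hlt
  set S : Finset ι := Finset.univ.filter (fun j => w j ≠ 0) with hS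
  have hcard : S.card = hammingNorm w := by simp [hS, hammingNorm]
  have hS2 : S.card = 2 := by omega
  obtain ⟨q, q', hqq, hqS⟩ := Finset.card_eq_two.mp hS2
  refine hqq (hinj q q' (funext fun i => ?_))
  have := congrFun hw i
  rw [mulVec_eq_sum_support, ← hS, hqS, Finset.sum_pair hqq] at this
  have key : ∀ x y : ZMod 2, x + y = 0 → x = y := by decide
  exact key _ _ this

set_option maxRecDepth 200000 in
/-- [folklore] -/
private theorem HX_col_injective :
    ∀ q q' : G36 ⊕ G36, (fun i => HX a36 b36 i q) = (fun i => HX a36 b36 i q') → q = q' := by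
  decide

set_option maxRecDepth 200000 in
/-- [folklore] -/
private theorem hammingNorm_u72 : hammingNorm u72 = 3 := by
  decide

/-- ★ **`LP[a6 ⊗ 1, 1 ⊗ (1+y)]` over `D₆ × ℤ₃`: `d_X = 2` and `d_Z = 3`** — so the distance is `2`, against the
printed `min(d_a, d_b) = 3`. [cite: LinPryadko2024, §IV.C "[[2n_an_b, 2k_ak_b, min(d_a,d_b)]]_q" (arXiv:2306.16400 chunk p0010 L77–79) — REFUTED for this non-abelian instance; `k = 12` computed outside Lean, not claimed] -/
theorem LinPryadko2024_sec4C_hp_counterexample_dX_dZ :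
    (css a36 b36).dX = 2 ∧ (css a36 b36).dZ = 3 := by
  refine ⟨LinPryadko2024_sec4C_hp_counterexample.1, ?_⟩
  have hu : u72 ∉ (css a36 b36).rowSpZ := by
    refine not_mem_rowSpace_of_witness x72 HZ_mulVec_x72 ?_
    rw [dotProduct_comm]
    exact u72_dot_x72
  exact (css a36 b36).dZ_eq_of_witness HX_mulVec_u72 hu hammingNorm_u72 fun w hw hw' =>
    three_le_hammingNorm_of_mulVec_eq_zero _ HX_col_ne_zero HX_col_injective hw
      fun h => hw' (h ▸ Submodule.zero_mem _)

end TwoBlockGA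

end Literature.InformationTheory.QuantumCodes
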